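import Literature.Topology.FourManifolds.NullCobordismHCobordism
import Literature.Topology.FourManifolds.RotationBodyRetract
import Literature.Topology.FourManifolds.HCobordantOfDiffeomorph
import Literature.Topology.FourManifolds.HomotopySpheresSumHomology
import Literature.Topology.FourManifolds.HomotopySpheresGroupAssembly
import Literature.Topology.FourManifolds.SmoothPoincareLowDim
import Literature.Topology.FourManifolds.HomotopySpheresSumDimTwoLeaves
import Literature.AlgebraicTopology.Homotopy.WhiteheadTheoremProofs
import Literature.AlgebraicTopology.Homotopy.WhiteheadContractibleLeavesProofs
import HarnessLib

/-!
# `Σ # (-Σ)` is h-cobordant to `𝕊ⁿ`, from Whitehead's theorem and the CW type of manifolds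

Topic `Literature/Topology/FourManifolds`. Kervaire–Milnor, *Groups of homotopy spheres I*,
Ann. of Math. 77 (1963), Lemmas 2.3–2.4 and proof of Thm 1.1 (pp. 506–507): "By Lemmas 2.3, 2.4,
each element of `Θₙ` has an inverse", i.e. `Σ # (-Σ)` is h-cobordant to `Sⁿ` — the tree's named
fact `Literature.Topology.FourManifolds.HomotopySphere.isHCobordant_sphere_of_isOrientedConnectedSum_neg`
(`HomotopySpheresGroup.lean`, `n ≥ 2`).

This file proves that fact GIVEN only the two standard homotopy-theoretic inputs already used by
the tree for "the sum of two homotopy spheres is a homotopy sphere"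
(`HomotopySpheresSumHomology.lean`): Whitehead's theorem (Hatcher 2002, Cor. 4.33, named fact
`Literature.AlgebraicTopology.Homotopy.whitehead_exists_homotopyEquiv`) and the CW homotopy type of
manifolds (Milnor 1959, Cor. 1, named fact
`Literature.AlgebraicTopology.Homotopy.Manifold.exists_cwComplex_homotopyEquiv`), together with — in
dimension `n = 2` only — the smooth Poincaré conjecture in dimension `2` (classification of
surfaces). Compared with the decomposition of `HomotopySpheresInverse.lean`, the leaves
`NullCobordism.isHomotopyEquiv_compl_ball_of_contractibleSpace` (whose printed proof uses Poincaré
duality) and `HomotopySphere.contractibleSpace_compl_singleton` (Whitehead–Hurewicz) are bypassed: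
the h-cobordism `(W ∖ i(B̊); Σ # (-Σ), 𝕊ⁿ)` is obtained from `NullCobordism.isHCobordant_sphere_of_whitehead`
(`NullCobordismHCobordism.lean`: orientation class of the interior instead of duality; only the
ACYCLICITY of `W`, not its contractibility) applied to Kervaire–Milnor's rotation body `W` of `Σ`
(`RotationBody*.lean`), which is simply connected and acyclic because `W ≃ₕ Σ ∖ {i 0}`
(`RotationData.homotopyEquivPunct`).

* `HomotopySphere.isHCobordant_sphere_P₀_of_whitehead`: the double `P₀ = Σ # (-Σ)` formed with one
  disc is h-cobordant to `𝕊ⁿ`;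
* `HomotopySphere.isHCobordant_sphere_of_isOrientedConnectedSum_neg_of_whitehead`: **the named fact,
  for every oriented connected sum `Σ # (-Σ)`** (Palais–Cerf uniqueness, a tree theorem, and
  transport of h-cobordisms along diffeomorphisms).

## References

* M. Kervaire, J. Milnor, *Groups of homotopy spheres I*, Ann. of Math. (2) 77 (1963), Lemmas 2.3,
  2.4 and proof of Thm 1.1 (pp. 506–507). doi:10.2307/1970128 [KervaireMilnorAnnals1963]
* A. Hatcher, *Algebraic Topology*, CUP (2002), Cor. 4.33. [HatcherAT2002]
* J. Milnor, *On spaces having the homotopy type of a CW-complex*, Trans. AMS 90 (1959), Cor. 1.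
  [Milnor1959]
-/

open scoped Manifold ContDiff Topology ContinuousMap
open Set Function Metric CategoryTheory CategoryTheory.Limits
open Literature.AlgebraicTopology.SingularHomology

noncomputable section

namespace Literature.Topology.FourManifolds

/-- Local notation: `𝔼 n` is the model Euclidean space `EuclideanSpace ℝ (Fin n)`. -/
local notation "𝔼 " n:arg => EuclideanSpace ℝ (Fin n)
/-- Local notation: `𝕊 n` is the unit sphere in `EuclideanSpace ℝ (Fin (n + 1))`. -/
local notation "𝕊 " n:arg => (Metric.sphere (0 : EuclideanSpace ℝ (Fin (n + 1))) 1)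

namespace HomotopySphere

variable {m : ℕ}

/-- **The rotation body of a homotopy sphere is simply connected** (`n = m + 1 ≥ 2`), GIVEN — for
`n = 2` only — the smooth Poincaré conjecture in dimension `2`: `W ≃ₕ Σ ∖ {i 0}`
(`RotationData.homotopyEquivPunct`), and a punctured homotopy `n`-sphere is simply connected for
`n ≥ 3` (general position, `simplyConnectedSpace_compl_singleton`) and contractible for `n = 2`
(`Σ ≅ S²`, stereographic projection). [cite: KervaireMilnorAnnals1963, Lemma 2.4, proof (p. 507)] -/
theorem simplyConnectedSpace_rotationBody (S : HomotopySphere (m + 1)) (R : RotationData m S.carrier)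
    (h2 : m = 1 → ∀ (M : Type) [TopologicalSpace M] [T2Space M] [SecondCountableTopology M],
      ContinuousMap.HomotopyEquiv.NonemptyDiffeomorphSphere M 2) (hm : 1 ≤ m) :
    SimplyConnectedSpace R.W := by
  haveI : SimplyConnectedSpace ↥R.Mpunct := by
    show SimplyConnectedSpace ↥(({R.i 0}ᶜ : Set S.carrier))
    rcases Nat.lt_or_ge m 2 with hlt | hge
    · obtain rfl : m = 1 := by omega
      haveI := contractibleSpace_compl_singleton_of_nonemptyDiffeomorphSphere (h2 rfl) S (R.i 0)
      infer_instance
    · exact S.simplyConnectedSpace_compl_singleton (by omega) (R.i 0)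
  exact R.homotopyEquivPunct.simplyConnectedSpace

/-- **The rotation body of a homotopy sphere is acyclic**: `Hₖ(W; ℤ) = 0` for `k ≥ 1`, since
`W ≃ₕ Σ ∖ {i 0}` and punctured homotopy spheres of dimension `≥ 2` are acyclic
(`isZero_singularHomology_compl_singleton`, Mayer–Vietoris). [cite: KervaireMilnorAnnals1963, Lemma 2.4, proof (p. 507)] -/
theorem isZero_singularHomology_rotationBody (S : HomotopySphere (m + 1)) (R : RotationData m S.carrier)
    (hm : 1 ≤ m) {k : ℕ} (hk : 1 ≤ k) : IsZero (singularHomology ℤ ℤ R.W k) :=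
  (S.isZero_singularHomology_compl_singleton (by omega) (R.i 0) hk).of_iso
    (singularHomology.isoOfHomotopyEquiv ℤ ℤ R.homotopyEquivPunct k)

/-- **The double `P₀ = Σ # (-Σ)` is simply connected** (`n ≥ 2`), GIVEN the smooth Poincaré
conjecture in dimension `2` for `n = 2`: for `n ≥ 3` by Seifert–van Kampen
(`simplyConnectedSpace_of_isConnectedSum`); for `n = 2` the sum is a homotopy `2`-sphere (the
suspension argument with contractible disc complements, `ConnectedSumNeck.nonempty_homotopyEquiv_sphere`).
[cite: KervaireMilnorAnnals1963, §2 p. 505] -/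
theorem simplyConnectedSpace_P₀ (S : HomotopySphere (m + 1)) (R : RotationData m S.carrier)
    (h2 : m = 1 → ∀ (M : Type) [TopologicalSpace M] [T2Space M] [SecondCountableTopology M],
      ContinuousMap.HomotopyEquiv.NonemptyDiffeomorphSphere M 2) (hm : 1 ≤ m) :
    SimplyConnectedSpace R.P₀ := by
  haveI := R.csd.t2Space_glued RotationData.hn
  rcases Nat.lt_or_ge m 2 with hlt | hge
  · obtain rfl : m = 1 := by omega
    have hK : ∀ {i : 𝔼 2 → S.carrier}, Manifold.IsSmoothEmbedding 𝓘(ℝ, 𝔼 2) (𝓡 2) ∞ i →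
        ContractibleSpace ↥((i '' ball (0 : 𝔼 2) 1)ᶜ) := fun hi =>
      contractibleSpace_compl_image_ball_of_nonemptyDiffeomorphSphere (h2 rfl) S hi
    obtain ⟨i₁, i₂, hi₁, hi₂, jA, jB, hjA, hAo, hjB, hBo, hU, hR⟩ := ConnectedSumData.isConnectedSum_glued R.csd RotationData.hn
    let d : ConnectedSumNeck 2 S.carrier S.carrier R.P₀ :=
      { i₁ := i₁
        i₂ := i₂
        jA := jA
        jB := jB
        continuous_i₁ := hi₁.isEmbedding.continuous
        injective_i₁ := hi₁.isEmbedding.injective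
        continuous_i₂ := hi₂.isEmbedding.continuous
        injective_i₂ := hi₂.isEmbedding.injective
        isEmbedding_jA := hjA.isEmbedding
        isEmbedding_jB := hjB.isEmbedding
        isOpen_range_jA := hAo
        isOpen_range_jB := hBo
        union_range := hU
        rel := hR }
    obtain ⟨e⟩ := d.nonempty_homotopyEquiv_sphere (hK hi₁) (hK hi₂)
    haveI : SimplyConnectedSpace (𝕊 2) := simplyConnectedSpace_euclideanSphere (by omega)
    exact e.simplyConnectedSpace
  · exact simplyConnectedSpace_of_isConnectedSum (by omega) S S R.P₀ (ConnectedSumData.isConnectedSum_glued R.csd RotationData.hn)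

/-- **The double `P₀ = Σ # (-Σ)` has the integral homology of `𝕊ⁿ`** (`n ≥ 2`): `Hₙ(P₀) ≅ ℤ` and
`Hₖ(P₀) = 0` for `0 < k ≠ n` (the pinch map `P₀ → 𝕊ⁿ` is a homology isomorphism,
`exists_isIso_singularHomology_map_of_isConnectedSum`; `Hₖ(𝕊ⁿ)` from `SphereHomology.lean`).
[cite: KervaireMilnorAnnals1963, §2 p. 505] -/
theorem homology_P₀ (S : HomotopySphere (m + 1)) (R : RotationData m S.carrier) (hm : 1 ≤ m) :
    Nonempty (singularHomology ℤ ℤ R.P₀ (m + 1) ≅ ModuleCat.of ℤ (ULift.{0} ℤ)) ∧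
      ∀ k, 1 ≤ k → k ≠ m + 1 → IsZero (singularHomology ℤ ℤ R.P₀ k) := by
  haveI := R.csd.t2Space_glued RotationData.hn
  obtain ⟨f, hf⟩ := exists_isIso_singularHomology_map_of_isConnectedSum (by omega) S S R.P₀
    (ConnectedSumData.isConnectedSum_glued R.csd RotationData.hn)
  refine ⟨?_, fun k hk hkn => ?_⟩
  · haveI := hf (m + 1)
    obtain ⟨e⟩ := nonempty_singularHomology_sphere_iso_holds ℤ ℤ (n := m + 1) (by omega)
    exact ⟨asIso (singularHomology.map ℤ ℤ f (m + 1)) ≪≫ e⟩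
  · haveI := hf k
    exact (isZero_singularHomology_sphere_holds ℤ ℤ (by omega) hkn).of_iso
      (asIso (singularHomology.map ℤ ℤ f k))

/-- **The double `P₀ = Σ # (-Σ)` formed with one disc is h-cobordant to `𝕊ⁿ`** (`n = m + 1 ≥ 2`),
GIVEN Whitehead's theorem, the CW homotopy type of manifolds and, for `n = 2`, the smooth Poincaré
conjecture in dimension `2`: `P₀` bounds the rotation body `W` (`RotationData.nullCobordism`), which
is simply connected and acyclic, and `P₀` is a simply connected homology sphere, so
`NullCobordism.isHCobordant_sphere_of_whitehead` applies (Kervaire–Milnor 1963, Lemmas 2.3–2.4).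
[cite: KervaireMilnorAnnals1963, Lemmas 2.3–2.4 (pp. 506–507)] -/
theorem isHCobordant_sphere_P₀_of_whitehead
    (hW : Literature.AlgebraicTopology.Homotopy.whitehead_exists_homotopyEquiv.{0})
    (hCW : Literature.AlgebraicTopology.Homotopy.Manifold.exists_cwComplex_homotopyEquiv.{0})
    (h2 : m = 1 → ∀ (M : Type) [TopologicalSpace M] [T2Space M] [SecondCountableTopology M],
      ContinuousMap.HomotopyEquiv.NonemptyDiffeomorphSphere M 2)
    (hm : 1 ≤ m) (S : HomotopySphere (m + 1)) (R : RotationData m S.carrier) :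
    FourManifolds.IsHCobordant (m + 1) R.P₀ (𝕊 (m + 1)) := by
  haveI := R.csd.t2Space_glued RotationData.hn
  haveI := R.csd.compactSpace_glued RotationData.hn
  haveI := R.csd.secondCountableTopology_glued RotationData.hn
  haveI := S.simplyConnectedSpace_P₀ R h2 hm
  haveI : Nonempty R.P₀ := inferInstance
  haveI : SimplyConnectedSpace R.nullCobordism.W := S.simplyConnectedSpace_rotationBody R h2 hm
  obtain ⟨htop, hmid⟩ := S.homology_P₀ R hm
  exact R.nullCobordism.isHCobordant_sphere_of_whitehead hW hCW hm
    (fun k hk => S.isZero_singularHomology_rotationBody R hm hk) htop hmid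

/-- **`Σ # (-Σ)` is h-cobordant to `𝕊ⁿ` for every oriented connected sum, `n ≥ 2` — the named fact
`HomotopySphere.isHCobordant_sphere_of_isOrientedConnectedSum_neg` from Whitehead's theorem, the CW
homotopy type of manifolds and the smooth Poincaré conjecture in dimension `2`** (Kervaire–Milnor,
*Groups of homotopy spheres I* (1963), Lemmas 2.3–2.4 and proof of Thm 1.1, pp. 506–507: "By
Lemmas 2.3, 2.4, each element of `Θₙ` has an inverse"). An arbitrary oriented connected sum `P` of
`(Σ, o)` and `(Σ, -o)` is diffeomorphic to the double `P₀` (Palais–Cerf uniqueness, tree theorem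
`exists_diffeomorph_isOrientationPreserving_of_isOrientedConnectedSum_euclidean`), and h-cobordism
is transported along diffeomorphisms (`IsHCobordant.of_diffeomorph_left`). The hypotheses are the
inputs the tree already uses for the p. 505 remark (`HomotopySpheresSumHomology.lean`); Poincaré
duality and the Hurewicz theorem, on which the printed proofs of Lemmas 2.3–2.4 draw, are not used.
[cite: KervaireMilnorAnnals1963, Lemmas 2.3–2.4 and proof of Thm. 1.1 (pp. 506–507)] [cite: HatcherAT2002, Cor. 4.33] [cite: Milnor1959, Cor. 1] -/
theorem isHCobordant_sphere_of_isOrientedConnectedSum_neg_of_whitehead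
    (hW : Literature.AlgebraicTopology.Homotopy.whitehead_exists_homotopyEquiv.{0})
    (hCW : Literature.AlgebraicTopology.Homotopy.Manifold.exists_cwComplex_homotopyEquiv.{0})
    (h2 : ∀ (M : Type) [TopologicalSpace M] [T2Space M] [SecondCountableTopology M],
      ContinuousMap.HomotopyEquiv.NonemptyDiffeomorphSphere M 2) :
    isHCobordant_sphere_of_isOrientedConnectedSum_neg := by
  intro n S P _ _ _ _ _ _ oP hn hP
  obtain ⟨m, rfl⟩ : ∃ m, n = m + 1 := ⟨n - 1, by omega⟩
  have hm : 1 ≤ m := by omega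
  haveI : Nonempty S.carrier := S.nonempty
  obtain ⟨R⟩ := nonempty_rotationData (m := m) (M := S.carrier)
  obtain ⟨o₀, ho⟩ := R.exists_isOrientationPreserving_i S.orientation
  haveI := R.csd.t2Space_glued RotationData.hn
  haveI := R.csd.compactSpace_glued RotationData.hn
  haveI := R.csd.secondCountableTopology_glued RotationData.hn
  haveI := S.connectedSpace (by omega)
  -- `P ≅ P₀` by Palais–Cerf uniqueness
  obtain ⟨φ, -⟩ := exists_diffeomorph_isOrientationPreserving_of_isOrientedConnectedSum_euclidean hP
    (R.isOrientedConnectedSum_P₀ S.orientation o₀ ho)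
  exact (isHCobordant_sphere_P₀_of_whitehead hW hCW (fun _ => h2) hm S R).of_diffeomorph_left φ

/-- **The named fact `HomotopySphere.isHCobordant_sphere_of_isOrientedConnectedSum_neg` from three
named facts of the tree** — the DAG edge of `…_of_whitehead` made explicit: Whitehead's theorem
(`Literature.AlgebraicTopology.Homotopy.whitehead_exists_homotopyEquiv`, Hatcher 2002, Cor. 4.33), the
CW homotopy type of manifolds (`Literature.AlgebraicTopology.Homotopy.Manifold.exists_cwComplex_homotopyEquiv`,
Milnor 1959, Cor. 1) and the smooth Poincaré conjecture in dimension `2`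
(`Literature.Topology.FourManifolds.nonemptyDiffeomorphSphere_two`, `SmoothPoincareLowDim.lean`;
classification of surfaces). Discharging these three facts discharges the target
(Kervaire–Milnor 1963, Lemmas 2.3–2.4 and proof of Thm 1.1, pp. 506–507).
[cite: KervaireMilnorAnnals1963, Lemmas 2.3–2.4 and proof of Thm. 1.1 (pp. 506–507)] -/
theorem isHCobordant_sphere_of_isOrientedConnectedSum_neg_of_namedFacts
    (hW : Literature.AlgebraicTopology.Homotopy.whitehead_exists_homotopyEquiv.{0})
    (hCW : Literature.AlgebraicTopology.Homotopy.Manifold.exists_cwComplex_homotopyEquiv.{0})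
    (h2 : nonemptyDiffeomorphSphere_two.{0}) :
    isHCobordant_sphere_of_isOrientedConnectedSum_neg :=
  isHCobordant_sphere_of_isOrientedConnectedSum_neg_of_whitehead hW hCW fun M _ _ _ => h2 M

/-! ### Discharging the leaves: `n ≥ 3` unconditionally, `n = 2` from one statement of Morse theory

Since the reduction above was written the tree PROVED all its homotopy-theoretic inputs:

* Whitehead's theorem for weak homotopy equivalences of CW complexes (Hatcher Thm. 4.5),
  `Literature.AlgebraicTopology.Homotopy.whitehead_exists_homotopyEquiv_of_isWeakHomotopyEquiv_holds`
  (`WeakHomotopyEquivalenceProofs.lean`);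
* the relative Hurewicz theorem in vanishing form (Miller Cor. 65.5),
  `Literature.AlgebraicTopology.SingularHomology.relativeHurewicz_subsingleton_holds`
  (`RelativeHurewiczConeProofs.lean`), whence "homology isomorphisms between simply connected spaces
  are weak equivalences" (Miller Cor. 65.7,
  `isWeakHomotopyEquiv_of_isIso_singularHomologyMap_holds`, `HomologyWeakEquivalence.lean`) and
  Whitehead's Cor. 4.33 (`whitehead_exists_homotopyEquiv_holds`, `WhiteheadTheoremProofs.lean`);
* Milnor's theorem on the CW type of manifolds (Milnor 1959, Cor. 1),
  `Literature.AlgebraicTopology.Homotopy.Manifold.exists_cwComplex_homotopyEquiv_holds`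
  (`WhiteheadContractibleLeavesProofs.lean`).

Consequently (this section, all PROVED): the target fact holds outright in dimensions `n ≥ 3`
(`isHCobordant_sphere_of_isOrientedConnectedSum_neg_three_le`), and in general it follows from
the smooth Poincaré conjecture in dimension `2` ALONE (`…_of_sphere_two`), hence — through the
tree's Morse-theoretic reductions of `Θ₂ = 0` (`HomotopySpheresSumDimTwoLeaves.lean`,
`SmoothPoincareTwoMorse.lean`) — from any one of: Matsumoto's Thm. 3.35 in dimension `2`
(`…_of_niceMorse`), spc4.S24 (b) in dimension `2` (`…_of_exists_isSelfIndexing`), Milnor's First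
Cancellation Theorem 5.4 on a slab (`…_of_firstCancellation_slab`), Assertion 6 of its proof
(`…_of_modelChart`), or the level deformation in the general case of Assertion 6
(`…_of_levelDeformation`, the finest current leaf). The discharge `isHCobordant_sphere_of_isOrientedConnectedSum_neg_holds` is
`…_of_sphere_two nonemptyDiffeomorphSphere_two_holds` once `Θ₂ = 0` lands. -/

/-- **`Σ # (-Σ)` is h-cobordant to `𝕊ⁿ` for every oriented connected sum of a homotopy `n`-sphere
with its reverse, `n ≥ 3` — PROVED** (Kervaire–Milnor, *Groups of homotopy spheres I* (1963),
Lemmas 2.3–2.4 and proof of Thm 1.1, pp. 506–507; the range in which Thm 1.1 is used). This is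
the target fact `HomotopySphere.isHCobordant_sphere_of_isOrientedConnectedSum_neg` with `2 ≤ n`
strengthened to `3 ≤ n`, now unconditional: `isHCobordant_sphere_P₀_of_whitehead` fed with the
tree's theorems `whitehead_exists_homotopyEquiv_holds` and
`Manifold.exists_cwComplex_homotopyEquiv_holds` (its dimension-`2` hypothesis being vacuous), and Palais–Cerf uniqueness of oriented connected sums
(`exists_diffeomorph_isOrientationPreserving_of_isOrientedConnectedSum_euclidean`) to pass from the
double `P₀` to an arbitrary sum `P`. [cite: KervaireMilnorAnnals1963, Lemmas 2.3–2.4 and proof of Thm. 1.1 (pp. 506–507)] -/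
theorem isHCobordant_sphere_of_isOrientedConnectedSum_neg_three_le
    (n : ℕ) (S : HomotopySphere n) (P : Type) [TopologicalSpace P] [T2Space P]
    [SecondCountableTopology P] [ChartedSpace (𝔼 n) P] [IsManifold (𝓡 n) ∞ P] [CompactSpace P]
    (oP : SmoothOrientation (𝓡 n) P) (hn : 3 ≤ n)
    (hP : IsOrientedConnectedSum S.orientation (-S.orientation) oP) :
    FourManifolds.IsHCobordant n P (𝕊 n) := by
  obtain ⟨m, rfl⟩ : ∃ m, n = m + 1 := ⟨n - 1, by omega⟩
  have hm : 1 ≤ m := by omega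
  haveI : Nonempty S.carrier := S.nonempty
  obtain ⟨R⟩ := nonempty_rotationData (m := m) (M := S.carrier)
  obtain ⟨o₀, ho⟩ := R.exists_isOrientationPreserving_i S.orientation
  haveI := R.csd.t2Space_glued RotationData.hn
  haveI := R.csd.compactSpace_glued RotationData.hn
  haveI := R.csd.secondCountableTopology_glued RotationData.hn
  haveI := S.connectedSpace (by omega)
  -- `P ≅ P₀` by Palais–Cerf uniqueness
  obtain ⟨φ, -⟩ := exists_diffeomorph_isOrientationPreserving_of_isOrientedConnectedSum_euclidean hP
    (R.isOrientedConnectedSum_P₀ S.orientation o₀ ho)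
  exact (isHCobordant_sphere_P₀_of_whitehead
    Literature.AlgebraicTopology.Homotopy.whitehead_exists_homotopyEquiv_holds.{0}
    Literature.AlgebraicTopology.Homotopy.Manifold.exists_cwComplex_homotopyEquiv_holds.{0}
    (fun h => absurd h (by omega)) hm S R).of_diffeomorph_left φ

/-- **The target fact from `Θ₂ = 0` alone.** `HomotopySphere.isHCobordant_sphere_of_isOrientedConnectedSum_neg`
(Kervaire–Milnor 1963, Lemmas 2.3–2.4: `Σ # (-Σ)` is h-cobordant to `𝕊ⁿ`, `n ≥ 2`) follows from
the smooth Poincaré conjecture in dimension `2` (`nonemptyDiffeomorphSphere_two`,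
`SmoothPoincareLowDim.lean`; Kervaire–Milnor p. 507, "`Θ₂ = 0`", used only for `n = 2`), every
other input of `isHCobordant_sphere_of_isOrientedConnectedSum_neg_of_namedFacts` being a theorem
of the tree (`whitehead_exists_homotopyEquiv_holds`, `Manifold.exists_cwComplex_homotopyEquiv_holds`).
[cite: KervaireMilnorAnnals1963, Lemmas 2.3–2.4 and proof of Thm. 1.1 (pp. 506–507)] -/
theorem isHCobordant_sphere_of_isOrientedConnectedSum_neg_of_sphere_two
    (h2 : nonemptyDiffeomorphSphere_two.{0}) :
    isHCobordant_sphere_of_isOrientedConnectedSum_neg :=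
  isHCobordant_sphere_of_isOrientedConnectedSum_neg_of_namedFacts
    Literature.AlgebraicTopology.Homotopy.whitehead_exists_homotopyEquiv_holds.{0}
    Literature.AlgebraicTopology.Homotopy.Manifold.exists_cwComplex_homotopyEquiv_holds.{0} h2

/-- **The target fact from Matsumoto's Thm. 3.35 in dimension `2`** (a closed connected surface
carries a Morse function with exactly one critical point of index `0` and one of index `2`; tree
named fact `exists_isMorse_ncard_criticalSetOfIndex_eq_one 2`), through `Θ₂ = 0`
(`nonemptyDiffeomorphSphere_two_of_niceMorse`, `HomotopySpheresSumDimTwoLeaves.lean`).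
[cite: KervaireMilnorAnnals1963, Lemmas 2.3–2.4 (pp. 506–507)] [cite: Matsumoto2001, Thm. 3.35] -/
theorem isHCobordant_sphere_of_isOrientedConnectedSum_neg_of_niceMorse
    (hU : exists_isMorse_ncard_criticalSetOfIndex_eq_one.{0} 2) :
    isHCobordant_sphere_of_isOrientedConnectedSum_neg :=
  isHCobordant_sphere_of_isOrientedConnectedSum_neg_of_sphere_two
    (nonemptyDiffeomorphSphere_two_of_niceMorse hU)

/-- **The target fact from spc4.S24 (b) in dimension `2`** (`exists_isMorse_isSelfIndexing 2`),
through `nonemptyDiffeomorphSphere_two_of_exists_isSelfIndexing`.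
[cite: KervaireMilnorAnnals1963, Lemmas 2.3–2.4 (pp. 506–507)] -/
theorem isHCobordant_sphere_of_isOrientedConnectedSum_neg_of_exists_isSelfIndexing
    (hS : FourManifolds.exists_isMorse_isSelfIndexing.{0} 2) :
    isHCobordant_sphere_of_isOrientedConnectedSum_neg :=
  isHCobordant_sphere_of_isOrientedConnectedSum_neg_of_sphere_two
    (nonemptyDiffeomorphSphere_two_of_exists_isSelfIndexing hS)

/-- **The target fact from Milnor's First Cancellation Theorem 5.4 on a slab**
(`Cobordism.Milnor1965_firstCancellation_slab`), through
`nonemptyDiffeomorphSphere_two_of_firstCancellation_slab`.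
[cite: KervaireMilnorAnnals1963, Lemmas 2.3–2.4 (pp. 506–507)] [cite: MilnorHCobordism1965, Thm. 5.4] -/
theorem isHCobordant_sphere_of_isOrientedConnectedSum_neg_of_firstCancellation_slab
    (h54 : Cobordism.Milnor1965_firstCancellation_slab.{0}) :
    isHCobordant_sphere_of_isOrientedConnectedSum_neg :=
  isHCobordant_sphere_of_isOrientedConnectedSum_neg_of_sphere_two
    (nonemptyDiffeomorphSphere_two_of_firstCancellation_slab h54)

/-- **The target fact from Assertion 6 of the proof of Milnor's Thm. 5.4**
(`Cobordism.Milnor1965_cancellation_modelChart`), through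
`nonemptyDiffeomorphSphere_two_of_modelChart`.
[cite: KervaireMilnorAnnals1963, Lemmas 2.3–2.4 (pp. 506–507)] [cite: MilnorHCobordism1965, proof of Thm. 5.4, Assertion 6] -/
theorem isHCobordant_sphere_of_isOrientedConnectedSum_neg_of_modelChart
    (hE : Cobordism.Milnor1965_cancellation_modelChart.{0}) :
    isHCobordant_sphere_of_isOrientedConnectedSum_neg :=
  isHCobordant_sphere_of_isOrientedConnectedSum_neg_of_sphere_two
    (nonemptyDiffeomorphSphere_two_of_modelChart hE)

/-- **The target fact from the finest current leaf of the tree's proof of Milnor's Thm. 5.4**: the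
deformation of the level diffeomorphism in the general case of Assertion 6
(`Cobordism.Milnor1965_cancellation_levelDeformation`; Milnor 1965, proof of Thm. 5.4, PDF
pp. 31–32 with Thm. 5.6). Assertion 6 (`Cobordism.Milnor1965_cancellation_modelChart`) is
assembled from it and the proved aligned charts and chart gluing by
`Cobordism.Milnor1965_cancellation_modelChart_of_parts` (`HCobordismModelChart.lean`), exactly as in
`HomotopySphere.boundsContractible_of_isOrientedConnectedSum_neg_of_levelDeformation`
(`HomotopySpheresInverseAssembly.lean`); then `…_of_modelChart`.
[cite: KervaireMilnorAnnals1963, Lemmas 2.3–2.4 (pp. 506–507)] [cite: MilnorHCobordism1965, proof of Thm. 5.4, Assertion 6 (PDF pp. 31–32)] -/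
theorem isHCobordant_sphere_of_isOrientedConnectedSum_neg_of_levelDeformation
    (hD : Cobordism.Milnor1965_cancellation_levelDeformation.{0}) :
    isHCobordant_sphere_of_isOrientedConnectedSum_neg :=
  isHCobordant_sphere_of_isOrientedConnectedSum_neg_of_modelChart
    (Cobordism.Milnor1965_cancellation_modelChart_of_parts
      Cobordism.Milnor1965_cancellation_alignedCharts_holds
      (Cobordism.Milnor1965_cancellation_levelIsotopy_of_deformation hD)
      Cobordism.Milnor1965_cancellation_glueCharts_holds)

/-! ### The same with the dimension-`2` input in the shape "punctured homotopy spheres are contractible"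

The dimension-`2` input enters only through the contractibility of `Σ ∖ {p}` and of `Σ ∖ i(B)`
for a homotopy `2`-sphere `Σ`. The tree carries this statement as its own named fact
`HomotopySphere.contractibleSpace_compl_image_ball` (`HomotopySpheresSum.lean`; Kosinski 1993,
VI §1), proved for `n ≠ 2` and reduced for `n = 2` to the same Morse-theoretic leaf by Reeb's
theorem (`HomotopySpheresSumDimTwoLeaves.lean`), without passing through `Θ₂ = 0`. The variants
below take that fact (for the homotopy sphere at hand, in dimension `2` only) in place of
`nonemptyDiffeomorphSphere_two`, so that the target is discharged by whichever of the two facts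
lands first. -/

/-- **The rotation body is simply connected**, variant of `simplyConnectedSpace_rotationBody` with
the dimension-`2` input as contractibility of disc complements in `Σ` (`hB`, used for `m = 1`
only; `Σ ∖ {i 0} ≃ₕ Σ ∖ i(B)`, `BallComplement.homotopyEquiv`). [cite: KervaireMilnorAnnals1963, Lemma 2.4, proof (p. 507)] -/
theorem simplyConnectedSpace_rotationBody_of_compl_image_ball (S : HomotopySphere (m + 1))
    (R : RotationData m S.carrier)
    (hB : m = 1 → ∀ (i : 𝔼 (m + 1) → S.carrier),
      Manifold.IsSmoothEmbedding 𝓘(ℝ, 𝔼 (m + 1)) (𝓡 (m + 1)) ∞ i →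
        ContractibleSpace ↥((i '' ball (0 : 𝔼 (m + 1)) 1)ᶜ)) (hm : 1 ≤ m) :
    SimplyConnectedSpace R.W := by
  haveI : SimplyConnectedSpace ↥R.Mpunct := by
    show SimplyConnectedSpace ↥(({R.i 0}ᶜ : Set S.carrier))
    rcases Nat.lt_or_ge m 2 with hlt | hge
    · obtain rfl : m = 1 := by omega
      haveI := hB rfl R.i R.isSmoothEmbedding_i
      haveI : ContractibleSpace ↥(({R.i 0}ᶜ : Set S.carrier)) :=
        (Literature.AlgebraicTopology.Homotopy.BallComplement.homotopyEquiv R.isOpenEmbedding_i).symm.contractibleSpace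
      infer_instance
    · exact S.simplyConnectedSpace_compl_singleton (by omega) (R.i 0)
  exact R.homotopyEquivPunct.simplyConnectedSpace

/-- **The double `P₀ = Σ # (-Σ)` is simply connected**, variant of `simplyConnectedSpace_P₀` with
the dimension-`2` input as contractibility of disc complements in `Σ` (`hB`, `m = 1` only).
[cite: KervaireMilnorAnnals1963, §2 p. 505] -/
theorem simplyConnectedSpace_P₀_of_compl_image_ball (S : HomotopySphere (m + 1))
    (R : RotationData m S.carrier)
    (hB : m = 1 → ∀ (i : 𝔼 (m + 1) → S.carrier),
      Manifold.IsSmoothEmbedding 𝓘(ℝ, 𝔼 (m + 1)) (𝓡 (m + 1)) ∞ i →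
        ContractibleSpace ↥((i '' ball (0 : 𝔼 (m + 1)) 1)ᶜ)) (hm : 1 ≤ m) :
    SimplyConnectedSpace R.P₀ := by
  haveI := R.csd.t2Space_glued RotationData.hn
  rcases Nat.lt_or_ge m 2 with hlt | hge
  · obtain rfl : m = 1 := by omega
    have hK : ∀ {i : 𝔼 2 → S.carrier}, Manifold.IsSmoothEmbedding 𝓘(ℝ, 𝔼 2) (𝓡 2) ∞ i →
        ContractibleSpace ↥((i '' ball (0 : 𝔼 2) 1)ᶜ) := fun hi => hB rfl _ hi
    obtain ⟨i₁, i₂, hi₁, hi₂, jA, jB, hjA, hAo, hjB, hBo, hU, hR⟩ :=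
      ConnectedSumData.isConnectedSum_glued R.csd RotationData.hn
    let d : ConnectedSumNeck 2 S.carrier S.carrier R.P₀ :=
      { i₁ := i₁
        i₂ := i₂
        jA := jA
        jB := jB
        continuous_i₁ := hi₁.isEmbedding.continuous
        injective_i₁ := hi₁.isEmbedding.injective
        continuous_i₂ := hi₂.isEmbedding.continuous
        injective_i₂ := hi₂.isEmbedding.injective
        isEmbedding_jA := hjA.isEmbedding
        isEmbedding_jB := hjB.isEmbedding
        isOpen_range_jA := hAo
        isOpen_range_jB := hBo
        union_range := hU
        rel := hR }
    obtain ⟨e⟩ := d.nonempty_homotopyEquiv_sphere (hK hi₁) (hK hi₂)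
    haveI : SimplyConnectedSpace (𝕊 2) := simplyConnectedSpace_euclideanSphere (by omega)
    exact e.simplyConnectedSpace
  · exact simplyConnectedSpace_of_isConnectedSum (by omega) S S R.P₀
      (ConnectedSumData.isConnectedSum_glued R.csd RotationData.hn)

/-- **`P₀ = Σ # (-Σ)` is h-cobordant to `𝕊ⁿ`**, variant of `isHCobordant_sphere_P₀_of_whitehead`
with the dimension-`2` input as contractibility of disc complements in `Σ` (`hB`, `m = 1` only).
[cite: KervaireMilnorAnnals1963, Lemmas 2.3–2.4 (pp. 506–507)] -/
theorem isHCobordant_sphere_P₀_of_compl_image_ball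
    (hW : Literature.AlgebraicTopology.Homotopy.whitehead_exists_homotopyEquiv.{0})
    (hCW : Literature.AlgebraicTopology.Homotopy.Manifold.exists_cwComplex_homotopyEquiv.{0})
    (hm : 1 ≤ m) (S : HomotopySphere (m + 1)) (R : RotationData m S.carrier)
    (hB : m = 1 → ∀ (i : 𝔼 (m + 1) → S.carrier),
      Manifold.IsSmoothEmbedding 𝓘(ℝ, 𝔼 (m + 1)) (𝓡 (m + 1)) ∞ i →
        ContractibleSpace ↥((i '' ball (0 : 𝔼 (m + 1)) 1)ᶜ)) :
    FourManifolds.IsHCobordant (m + 1) R.P₀ (𝕊 (m + 1)) := by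
  haveI := R.csd.t2Space_glued RotationData.hn
  haveI := R.csd.compactSpace_glued RotationData.hn
  haveI := R.csd.secondCountableTopology_glued RotationData.hn
  haveI := S.simplyConnectedSpace_P₀_of_compl_image_ball R hB hm
  haveI : Nonempty R.P₀ := inferInstance
  haveI : SimplyConnectedSpace R.nullCobordism.W :=
    S.simplyConnectedSpace_rotationBody_of_compl_image_ball R hB hm
  obtain ⟨htop, hmid⟩ := S.homology_P₀ R hm
  exact R.nullCobordism.isHCobordant_sphere_of_whitehead hW hCW hm
    (fun k hk => S.isZero_singularHomology_rotationBody R hm hk) htop hmid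

/-- **The target fact from "punctured homotopy spheres are contractible" alone**: the named fact
`HomotopySphere.isHCobordant_sphere_of_isOrientedConnectedSum_neg` follows from the tree's named
fact `HomotopySphere.contractibleSpace_compl_image_ball` (`HomotopySpheresSum.lean`; Kosinski
1993, VI §1: `Σ ∖ i(B)` is contractible — needed here for `n = 2` only, its cases `n ≠ 2` being
theorems of the tree), Whitehead's theorem and Milnor's CW type of manifolds being proved
(`whitehead_exists_homotopyEquiv_holds`, `Manifold.exists_cwComplex_homotopyEquiv_holds`).
[cite: KervaireMilnorAnnals1963, Lemmas 2.3–2.4 and proof of Thm. 1.1 (pp. 506–507)] [cite: Kosinski1993, Ch. VI §1 (remark before Cor. 1.4)] -/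
theorem isHCobordant_sphere_of_isOrientedConnectedSum_neg_of_contractibleSpace_compl_image_ball
    (hK : contractibleSpace_compl_image_ball) :
    isHCobordant_sphere_of_isOrientedConnectedSum_neg := by
  intro n S P _ _ _ _ _ _ oP hn hP
  obtain ⟨m, rfl⟩ : ∃ m, n = m + 1 := ⟨n - 1, by omega⟩
  have hm : 1 ≤ m := by omega
  haveI : Nonempty S.carrier := S.nonempty
  obtain ⟨R⟩ := nonempty_rotationData (m := m) (M := S.carrier)
  obtain ⟨o₀, ho⟩ := R.exists_isOrientationPreserving_i S.orientation
  haveI := R.csd.t2Space_glued RotationData.hn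
  haveI := R.csd.compactSpace_glued RotationData.hn
  haveI := R.csd.secondCountableTopology_glued RotationData.hn
  haveI := S.connectedSpace (by omega)
  -- `P ≅ P₀` by Palais–Cerf uniqueness
  obtain ⟨φ, -⟩ := exists_diffeomorph_isOrientationPreserving_of_isOrientedConnectedSum_euclidean hP
    (R.isOrientedConnectedSum_P₀ S.orientation o₀ ho)
  exact (isHCobordant_sphere_P₀_of_compl_image_ball
    Literature.AlgebraicTopology.Homotopy.whitehead_exists_homotopyEquiv_holds.{0}
    Literature.AlgebraicTopology.Homotopy.Manifold.exists_cwComplex_homotopyEquiv_holds.{0}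
    hm S R (fun _ i hi => hK (m + 1) S i hi)).of_diffeomorph_left φ

/-- **The target fact from the cancellation of a superfluous minimum in dimension `2`** (the leaf
`exists_isMorse_ncard_criticalSetOfIndex_zero_add_one_eq 2` of `MorseSingleMinimum.lean`;
Matsumoto 2001, proof of Thm. 3.35 / Milnor 1965, Thm. 8.1), through the Reeb route
`HomotopySphere.contractibleSpace_compl_image_ball_of_cancel` (`HomotopySpheresSumDimTwoLeaves.lean`).
[cite: KervaireMilnorAnnals1963, Lemmas 2.3–2.4 (pp. 506–507)] [cite: Matsumoto2001, Thm. 3.35] -/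
theorem isHCobordant_sphere_of_isOrientedConnectedSum_neg_of_cancel
    (hc : exists_isMorse_ncard_criticalSetOfIndex_zero_add_one_eq.{0} 2) :
    isHCobordant_sphere_of_isOrientedConnectedSum_neg :=
  isHCobordant_sphere_of_isOrientedConnectedSum_neg_of_contractibleSpace_compl_image_ball
    (contractibleSpace_compl_image_ball_of_cancel hc)

end HomotopySphere

end Literature.Topology.FourManifolds
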